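import Summits.QuantumFields.YangMills.Theorems.VirialFluxGapFixOrbitStructure
import Summits.QuantumFields.YangMills.Theorems.VirialFluxGapFixWindowDatum
import Summits.QuantumFields.YangMills.Theorems.VirialFluxGapSharpTwistedLaplaceFixTubes
import HarnessLib

/-!
# ★★★ The per-tube Laplace estimate on `X_fix` from SLICE DATA ALONE (all structural hypotheses of the orbit theorem discharged)
# (layers (B2)+(B3) of the DIRECT Laplace road to ⟨stmt-QuantumFields-24204⟩ `VirialFluxGap.SharpTwistedLaplace`)

Helper module (free-hands work of width seat ym-line-sfw-p2-w3 g57, cell ym-idea-1; `--supports 24204`).  INTEGRATION of the B2 keystone: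
✓`laplaceMethod_quantitative_orbit_tube` is applied on the tree-gauged ring space `X_fix(L)` with `K = SU(2)` (residual constant gauge
transformations, ✓`VirialFluxGapFixGaugeAction`), the Euclidean slice `σ(y) = fixSlice(fixCoord y)` through the critical configuration with anchors
`(C₀, ±N₀)` and rest base point `Rb` (✓`…FixSliceDefs`, ✓`…FixCoordDefs`), the group window `e = expPoint` on `Φ = B̄_{r₀} ⊂ ℝ³`, `S = {±1}`,
`ν = Haar probability`, `κ = Leb³`, the density `J = restWeight · anchorDensity` — with EVERY structural hypothesis supplied by the tree:
`hact hmul hone hpres` (…FixGaugeAction), `hσ hΘ hΘm hΘ' hΘ'm hslice hfix hT hA hJint hc0 hctop` (…FixOrbitStructure), `hloc` (✓`fix_hloc`,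
…FixSliceChartV), `hw` (✓`exists_fix_window_datum`, …FixWindowDatum), `hfinv` (✓`ringDeficit_fix_fixGaugeAct`).
* ★★★ `fix_htube_of_sliceData` — there are constants `0 < r₀ < 1`, `D, G ≥ 0`, `A₀, c_ν > 0` depending ONLY on the anchor data such that for
  every `L, e₀, y₀`, rest base point `Rb`, twist class `z`, and every SLICE DATUM (`A` symmetric with `⟪Ay,y⟫ ≥ λ‖y‖²`, cubic∕quartic remainders
  `cc, rr` with constants `A₃, A₄`, the phase expansion `F_fix(σ y) − F_fix(σ 0) = ½⟪Ay,y⟫ + cc y + rr y` on `‖y‖ ≤ R`, and a radius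
  `R ≤ r₀` with `A₃R + A₄R² ≤ λ/(8(n+8))`, `DR ≤ 1`, `GR² ≤ 1`), the tube `T = SU(2)·σ(B̄_R)` satisfies
  `|∫_T e^{−β(F_fix − F_fix(σ0))} dμ_fix − w₀𝔊(β)| ≤ (K/β)·w₀𝔊(β)`, `w₀ = A₀(2π²)^{−N}/c_ν`, `𝔊(β) = (2π/β)^{n/2}/√det A`, `n = fixDim`, with the
  explicit polynomial `K(n, λ, A₃, A₄, D, G, R)` of the orbit theorem — i.e. hypothesis `htube` of ✓`sharpTwistedLaplace_of_fixTubes` for this tube,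
  up to the identities `n = 18L⁴` and `F_fix(σ 0) = 0` (the critical value), which belong to the slice data.
WHAT REMAINS for ⟨24204⟩ after this file (all ANALYTIC, per sign class): the slice datum (`A, λ ≥ 1/poly(L)`, `A₃, A₄ ≤ poly(L)` from ✓`RingChartPhase`
restricted along `fixSlice`, `F_fix(σ 0) = 0`), `fixDim = 18L⁴` (comb-tree count), `log det A = O(poly L)`, and the off-tube floor `hfloor`.
Everything here is PROVED; no definitions, no named facts.  HONEST FRAMING: CONDITIONAL assembly (conditional on the slice data); ⟨24204⟩, ⟨24319⟩
and every rung stay OPEN; the Yang–Mills mass gap (Clay) is NOT touched; no summit is proved by a line.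

## References
* K. W. Breitung, *Asymptotic Approximations for Probability Integrals*, LNM 1592 (1994), Thm 41 p. 56; §2.3. [Breitung1994]
* G. E. Bredon, *Introduction to Compact Transformation Groups* (1972), Ch. II §§4–5. [Bredon1972]
* M. Lüscher, *Nucl. Phys. B* 219 (1983) 233–261, §2. [Luscher1983]
-/

set_option autoImplicit false

noncomputable section

open MeasureTheory Set Filter Metric WithLp Module
open scoped ENNReal RealInnerProductSpace Pointwise
open Literature.MathematicalPhysics.QuantumLattice
open Literature.MathematicalPhysics.QuantumFieldTheory hiding SU2
open Literature.MathematicalPhysics.QuantumFieldTheory.Balaban1983to89.T4HaarSU2ExpChart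
open Literature.MathematicalPhysics.QuantumFieldTheory.Balaban1983to89.T4ExpWindowSmallField
open Summit.QuantumFields.YangMills.Theorems.FemtoTransferGap
open Summit.QuantumFields.YangMills.Theorems.FemtoTransferGap.TT
open Summit.QuantumFields.YangMills.Theorems.VirialFluxGap.AnchorSlice
open Summit.QuantumFields.YangMills.Theorems.VirialFluxGap.RingDeficit
open Summit.QuantumFields.YangMills.Theorems.QuantitativeLaplace

namespace Summit.QuantumFields.YangMills.Theorems.VirialFluxGap.FixSplit

/-- ★★★ **THE PER-TUBE LAPLACE ESTIMATE ON `X_fix` FROM SLICE DATA ALONE** (see the module docstring).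
[cite: Breitung1994, Thm 41 p. 56; §2.3 Definitions 4–5] [cite: Bredon1972, Ch. II §§4–5] [cite: Luscher1983, §2] -/
theorem fix_htube_of_sliceData {ωC ωN ωX : EuclideanSpace ℝ (Fin 3)} {C₀ N₀ : SU2} (hC : ‖ωC‖ = 1) (hN : ‖ωN‖ = 1)
    (hCN : ⟪ωC, ωN⟫ = 0) (hX : imQuat ωX = imQuat ωC * imQuat ωN) (hC₀ : su2Quat C₀ = imQuat ωC)
    (hN₀ : su2Quat N₀ = imQuat ωN ∨ su2Quat N₀ = -imQuat ωN) :
    ∃ r₀ D G A₀ cν : ℝ, 0 < r₀ ∧ r₀ < 1 ∧ 0 ≤ D ∧ 0 ≤ G ∧ 0 < A₀ ∧ 0 < cν ∧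
      ∀ (L : ℕ) [NeZero L] (e₀ : OffIdx L) (y₀ : Site 3 L) (Rb : FixRest L e₀ y₀) (zc : Fin 3 → Bool)
        (A : EuclideanSpace ℝ (Fin (fixDim L e₀ y₀)) →ₗ[ℝ] EuclideanSpace ℝ (Fin (fixDim L e₀ y₀))) (lam : ℝ)
        (hAs : A.IsSymmetric) (hlam : 0 < lam) (hcoer : ∀ y, lam * ‖y‖ ^ 2 ≤ ⟪A y, y⟫)
        (A₃ A₄ β R : ℝ) (hA₃ : 0 ≤ A₃) (hA₄ : 0 ≤ A₄) (hβ : 0 < β) (hR : 0 < R) (hRr : R ≤ r₀)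
        (hsmall : A₃ * R + A₄ * R ^ 2 ≤ lam / (8 * ((finrank ℝ (EuclideanSpace ℝ (Fin (fixDim L e₀ y₀))) : ℝ) + 8)))
        (hDR : D * R ≤ 1) (hGR : G * R ^ 2 ≤ 1)
        (cc rr : EuclideanSpace ℝ (Fin (fixDim L e₀ y₀)) → ℝ) (hc_meas : Measurable cc) (hr_meas : Measurable rr)
        (hc_odd : ∀ y, cc (-y) = -cc y)
        (hc : ∀ y, ‖y‖ ≤ R → |cc y| ≤ A₃ * ‖y‖ ^ 3) (hr : ∀ y, ‖y‖ ≤ R → |rr y| ≤ A₄ * ‖y‖ ^ 4)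
        (hf : ∀ y : EuclideanSpace ℝ (Fin (fixDim L e₀ y₀)), ‖y‖ ≤ R →
          ringDeficit L zc ((Fin.cons (glue (fixSlice ωC ωN ωX C₀ N₀ Rb (fixCoord y)).1) (fixSlice ωC ωN ωX C₀ N₀ Rb (fixCoord y)).2.1 :
              Fin (2 * L - 1 + 1) → GaugeConfig 3 L SU2), (fixSlice ωC ωN ωX C₀ N₀ Rb (fixCoord y)).2.2) -
            ringDeficit L zc ((Fin.cons (glue (fixSlice ωC ωN ωX C₀ N₀ Rb (fixCoord 0)).1) (fixSlice ωC ωN ωX C₀ N₀ Rb (fixCoord 0)).2.1 :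
              Fin (2 * L - 1 + 1) → GaugeConfig 3 L SU2), (fixSlice ωC ωN ωX C₀ N₀ Rb (fixCoord 0)).2.2) =
            (1 / 2) * ⟪A y, y⟫ + cc y + rr y),
        IntegrableOn (fun x : (OffIdx L → SU2) × ((Fin (2 * L - 1) → GaugeConfig 3 L SU2) × (Site 3 L → SU2)) =>
            Real.exp (-(β * (ringDeficit L zc ((Fin.cons (glue x.1) x.2.1 : Fin (2 * L - 1 + 1) → GaugeConfig 3 L SU2), x.2.2) -
              ringDeficit L zc ((Fin.cons (glue (fixSlice ωC ωN ωX C₀ N₀ Rb (fixCoord 0)).1) (fixSlice ωC ωN ωX C₀ N₀ Rb (fixCoord 0)).2.1 :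
                Fin (2 * L - 1 + 1) → GaugeConfig 3 L SU2), (fixSlice ωC ωN ωX C₀ N₀ Rb (fixCoord 0)).2.2)))))
          ((fun q : SU2 × EuclideanSpace ℝ (Fin (fixDim L e₀ y₀)) =>
            (((fun i => q.1 * (fixSlice ωC ωN ωX C₀ N₀ Rb (fixCoord q.2)).1 i * q.1⁻¹),
              ((fun j => gaugeTransform (fun _ : Site 3 L => q.1) ((fixSlice ωC ωN ωX C₀ N₀ Rb (fixCoord q.2)).2.1 j)),
                (fun s => q.1 * (fixSlice ωC ωN ωX C₀ N₀ Rb (fixCoord q.2)).2.2 s * q.1⁻¹))) :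
              (OffIdx L → SU2) × ((Fin (2 * L - 1) → GaugeConfig 3 L SU2) × (Site 3 L → SU2)))) ''
            ((univ : Set SU2) ×ˢ closedBall (0 : EuclideanSpace ℝ (Fin (fixDim L e₀ y₀))) R))
          ((Measure.pi fun _ : OffIdx L => haarProbability SU2).prod
            ((Measure.pi fun _ : Fin (2 * L - 1) => configMeasure SU2 L).prod (gaugeMeasure L))) ∧
        |(∫ x, Real.exp (-(β * (ringDeficit L zc ((Fin.cons (glue x.1) x.2.1 : Fin (2 * L - 1 + 1) → GaugeConfig 3 L SU2), x.2.2) -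
              ringDeficit L zc ((Fin.cons (glue (fixSlice ωC ωN ωX C₀ N₀ Rb (fixCoord 0)).1) (fixSlice ωC ωN ωX C₀ N₀ Rb (fixCoord 0)).2.1 :
                Fin (2 * L - 1 + 1) → GaugeConfig 3 L SU2), (fixSlice ωC ωN ωX C₀ N₀ Rb (fixCoord 0)).2.2))))
            ∂(((Measure.pi fun _ : OffIdx L => haarProbability SU2).prod
              ((Measure.pi fun _ : Fin (2 * L - 1) => configMeasure SU2 L).prod (gaugeMeasure L))).restrict
              ((fun q : SU2 × EuclideanSpace ℝ (Fin (fixDim L e₀ y₀)) =>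
                (((fun i => q.1 * (fixSlice ωC ωN ωX C₀ N₀ Rb (fixCoord q.2)).1 i * q.1⁻¹),
                  ((fun j => gaugeTransform (fun _ : Site 3 L => q.1) ((fixSlice ωC ωN ωX C₀ N₀ Rb (fixCoord q.2)).2.1 j)),
                    (fun s => q.1 * (fixSlice ωC ωN ωX C₀ N₀ Rb (fixCoord q.2)).2.2 s * q.1⁻¹))) :
                  (OffIdx L → SU2) × ((Fin (2 * L - 1) → GaugeConfig 3 L SU2) × (Site 3 L → SU2)))) ''
                ((univ : Set SU2) ×ˢ closedBall (0 : EuclideanSpace ℝ (Fin (fixDim L e₀ y₀))) R)))) -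
          (A₀ * (2 * Real.pi ^ 2)⁻¹ ^ Fintype.card ({i : OffIdx L // ¬ i = e₀} ⊕ ((Fin (2 * L - 1) × Edge 3 L) ⊕ {y : Site 3 L // ¬ y = y₀})) / cν *
            ((2 * Real.pi / β) ^ ((finrank ℝ (EuclideanSpace ℝ (Fin (fixDim L e₀ y₀))) : ℝ) / 2) / Real.sqrt (LinearMap.det A)))| ≤
          (16 * ((finrank ℝ (EuclideanSpace ℝ (Fin (fixDim L e₀ y₀))) : ℝ) + 8) / (lam * R ^ 2) +
              16 * G * ((finrank ℝ (EuclideanSpace ℝ (Fin (fixDim L e₀ y₀))) : ℝ) + 8) / lam +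
            256 * (A₄ + (A₃ + A₄ * R) * (D + G * R)) * ((finrank ℝ (EuclideanSpace ℝ (Fin (fixDim L e₀ y₀))) : ℝ) + 8) ^ 2 / lam ^ 2 +
            18432 * (A₃ + A₄ * R) ^ 2 * ((finrank ℝ (EuclideanSpace ℝ (Fin (fixDim L e₀ y₀))) : ℝ) + 8) ^ 3 / lam ^ 3) / β *
          (A₀ * (2 * Real.pi ^ 2)⁻¹ ^ Fintype.card ({i : OffIdx L // ¬ i = e₀} ⊕ ((Fin (2 * L - 1) × Edge 3 L) ⊕ {y : Site 3 L // ¬ y = y₀})) / cν *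
            ((2 * Real.pi / β) ^ ((finrank ℝ (EuclideanSpace ℝ (Fin (fixDim L e₀ y₀))) : ℝ) / 2) / Real.sqrt (LinearMap.det A))) := by
  -- constants from the window datum (anchor data only)
  obtain ⟨r₀, hr₀, hr₀1, D, G, A₀, hD, hG, hA₀, hA₀def, hdatum⟩ := exists_fix_window_datum hC hN hCN hX hC₀ hN₀
  have hc0 := fix_hc0 hr₀ hr₀1
  have hctop := fix_hctop r₀
  have hcν : 0 < (haarProbability SU2 (((expPoint '' closedBall (0 : EuclideanSpace ℝ (Fin 3)) r₀) * ({1, negOne} : Set SU2))⁻¹)).toReal :=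
    ENNReal.toReal_pos hc0 hctop
  refine ⟨r₀, D, G, A₀, (haarProbability SU2 (((expPoint '' closedBall (0 : EuclideanSpace ℝ (Fin 3)) r₀) * ({1, negOne} : Set SU2))⁻¹)).toReal,
    hr₀, hr₀1, hD, hG, hA₀, hcν, ?_⟩
  intro L _ e₀ y₀ Rb zc A lam hAs hlam hcoer A₃ A₄ β R hA₃ hA₄ hβ hR hRr hsmall hDR hGR cc rr hc_meas hr_meas hc_odd hc hr hf
  obtain ⟨ll, ee, hll_meas, hee_meas, hll_odd, hll, hee, hI⟩ := hdatum L e₀ y₀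
  haveI : IsProbabilityMeasure (gaugeMeasure L) := by unfold gaugeMeasure; infer_instance
  have hr₀π : r₀ < Real.pi / 2 := by linarith [Real.pi_gt_three]
  have hR1 : R < 1 := lt_of_le_of_lt hRr hr₀1
  have hJ0 : ∀ z ∈ closedBall (0 : EuclideanSpace ℝ (Fin 3)) r₀, ∀ y ∈ closedBall (0 : EuclideanSpace ℝ (Fin (fixDim L e₀ y₀))) R,
      0 ≤ (fun w : EuclideanSpace ℝ (Fin 3) × EuclideanSpace ℝ (Fin (fixDim L e₀ y₀)) =>
        restWeight (fixCoord w.2).2 * anchorDensity ωC ωN ωX C₀ N₀ (w.1, (fixCoord w.2).1)) (z, y) :=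
    fun z _ y _ => mul_nonneg (restWeight_nonneg _) (anchorDensity_nonneg _)
  have hw : ∀ y : EuclideanSpace ℝ (Fin (fixDim L e₀ y₀)), ‖y‖ ≤ R →
      ((∫ z in closedBall (0 : EuclideanSpace ℝ (Fin 3)) r₀, (fun w : EuclideanSpace ℝ (Fin 3) × EuclideanSpace ℝ (Fin (fixDim L e₀ y₀)) =>
        restWeight (fixCoord w.2).2 * anchorDensity ωC ωN ωX C₀ N₀ (w.1, (fixCoord w.2).1)) (z, y) ∂volume) /
        (haarProbability SU2 (((expPoint '' closedBall (0 : EuclideanSpace ℝ (Fin 3)) r₀) * ({1, negOne} : Set SU2))⁻¹)).toReal) *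
        (fun _ : (OffIdx L → SU2) × ((Fin (2 * L - 1) → GaugeConfig 3 L SU2) × (Site 3 L → SU2)) => (1 : ℝ)) (fixSlice ωC ωN ωX C₀ N₀ Rb (fixCoord y)) =
        (A₀ * (2 * Real.pi ^ 2)⁻¹ ^ Fintype.card ({i : OffIdx L // ¬ i = e₀} ⊕ ((Fin (2 * L - 1) × Edge 3 L) ⊕ {y : Site 3 L // ¬ y = y₀})) /
          (haarProbability SU2 (((expPoint '' closedBall (0 : EuclideanSpace ℝ (Fin 3)) r₀) * ({1, negOne} : Set SU2))⁻¹)).toReal) *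
          (1 + ll y + ee y) := by
    intro y hy
    show ((∫ z in closedBall (0 : EuclideanSpace ℝ (Fin 3)) r₀,
      restWeight (fixCoord y).2 * anchorDensity ωC ωN ωX C₀ N₀ (z, (fixCoord y).1) ∂volume) / _) * 1 = _
    rw [hI y (hy.trans hRr), mul_one]
    ring
  have h := laplaceMethod_quantitative_orbit_tube (V := EuclideanSpace ℝ (Fin (fixDim L e₀ y₀)))
    (act := fun (k : SU2) (x : (OffIdx L → SU2) × ((Fin (2 * L - 1) → GaugeConfig 3 L SU2) × (Site 3 L → SU2))) => ((((fun i => k * (x).1 i * k⁻¹), ((fun j => gaugeTransform (fun _ : Site 3 L => k) ((x).2.1 j)), (fun s => k * (x).2.2 s * k⁻¹))) : (OffIdx L → SU2) × ((Fin (2 * L - 1) → GaugeConfig 3 L SU2) × (Site 3 L → SU2)))))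
    (σ := fun y : EuclideanSpace ℝ (Fin (fixDim L e₀ y₀)) => fixSlice ωC ωN ωX C₀ N₀ Rb (fixCoord y)) (e := expPoint)
    (Θ := fun q : SU2 × EuclideanSpace ℝ (Fin (fixDim L e₀ y₀)) => ((((fun i => q.1 * (fixSlice ωC ωN ωX C₀ N₀ Rb (fixCoord q.2)).1 i * q.1⁻¹), ((fun j => gaugeTransform (fun _ : Site 3 L => q.1) ((fixSlice ωC ωN ωX C₀ N₀ Rb (fixCoord q.2)).2.1 j)), (fun s => q.1 * (fixSlice ωC ωN ωX C₀ N₀ Rb (fixCoord q.2)).2.2 s * q.1⁻¹))) : (OffIdx L → SU2) × ((Fin (2 * L - 1) → GaugeConfig 3 L SU2) × (Site 3 L → SU2)))))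
    (Θ' := fun w : EuclideanSpace ℝ (Fin 3) × EuclideanSpace ℝ (Fin (fixDim L e₀ y₀)) => fixWindowMap ωC ωN ωX C₀ N₀ Rb (w.1, fixCoord w.2))
    (Φ := closedBall (0 : EuclideanSpace ℝ (Fin 3)) r₀) (S := ({1, negOne} : Set SU2)) (ν := haarProbability SU2)
    (μ := (Measure.pi fun _ : OffIdx L => haarProbability SU2).prod
      ((Measure.pi fun _ : Fin (2 * L - 1) => configMeasure SU2 L).prod (gaugeMeasure L)))
    (κ := (volume : Measure (EuclideanSpace ℝ (Fin 3))))
    measurable_fixGaugeAct (fun k k' x => fixGaugeAct_mul k k' x) (fun x => fixGaugeAct_one x) (fun k => measurePreserving_fixGaugeAct k)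
    (measurable_fixSlice_fixCoord ωC ωN ωX C₀ N₀ Rb) (fun _ _ => rfl) (fix_hΘm ωC ωN ωX C₀ N₀ Rb)
    (fun z y => fixWindowMap_eq_act ωC ωN ωX C₀ N₀ Rb z (fixCoord y)) (fix_hΘ'm ωC ωN ωX C₀ N₀ Rb) hR
    (fun k y hy y' hy' hk => fix_hslice hC hN hCN hX hC₀ hN₀ Rb hR1 k y hy y' hy' hk)
    (fun s hs y _ => fix_hfix s hs _) (fix_hT ωC ωN ωX C₀ N₀ Rb R)
    (fix_hA hC hN hCN hX hC₀ hN₀ Rb measurableSet_closedBall hr₀π Subset.rfl hR1) measurableSet_closedBall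
    (J := fun w : EuclideanSpace ℝ (Fin 3) × EuclideanSpace ℝ (Fin (fixDim L e₀ y₀)) =>
      restWeight (fixCoord w.2).2 * anchorDensity ωC ωN ωX C₀ N₀ (w.1, (fixCoord w.2).1))
    (fix_hJm ωC ωN ωX C₀ N₀) hJ0
    (fun y hy => fix_hJint hC hN hCN hX hC₀ hN₀ measurableSet_closedBall Subset.rfl hR1 y hy)
    (fix_hloc hC hN hCN hX hC₀ hN₀ Rb measurableSet_closedBall hr₀π Subset.rfl hR1) hc0 hctop
    (f := fun x : (OffIdx L → SU2) × ((Fin (2 * L - 1) → GaugeConfig 3 L SU2) × (Site 3 L → SU2)) => ringDeficit L zc ((Fin.cons (glue x.1) x.2.1 : Fin (2 * L - 1 + 1) → GaugeConfig 3 L SU2), x.2.2))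
    (φ := fun _ : (OffIdx L → SU2) × ((Fin (2 * L - 1) → GaugeConfig 3 L SU2) × (Site 3 L → SU2)) => (1 : ℝ)) (measurable_ringDeficit_fix zc) measurable_const
    (fun k x => ringDeficit_fix_fixGaugeAct zc k x) (fun _ _ => rfl) hAs hlam hcoer hA₃ hA₄ hD hG hβ
    (w₀ := A₀ * (2 * Real.pi ^ 2)⁻¹ ^ Fintype.card ({i : OffIdx L // ¬ i = e₀} ⊕ ((Fin (2 * L - 1) × Edge 3 L) ⊕ {y : Site 3 L // ¬ y = y₀})) /
      (haarProbability SU2 (((expPoint '' closedBall (0 : EuclideanSpace ℝ (Fin 3)) r₀) * ({1, negOne} : Set SU2))⁻¹)).toReal)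
    (by positivity) hsmall hDR hGR hc_meas hr_meas hll_meas hee_meas hc_odd hll_odd hc hr
    (fun y hy => hll y (hy.trans hRr)) (fun y hy => hee y (hy.trans hRr)) hf hw
  simpa only [probReal_univ, one_mul, mul_one] using h

end Summit.QuantumFields.YangMills.Theorems.VirialFluxGap.FixSplit

end
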